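import Literature.Probability.LatticeModels.ZModTorusFrames
import Literature.MathematicalPhysics.QuantumFieldTheory.TorusChart
import HarnessLib

/-!
# Dyadic block towers on charted tori of arbitrary (non-dyadic) periods

The block geometry of a multiscale (renormalisation-group) analysis on a charted discrete torus
`Λ ≅ ∏ᵢ ℤ/N_iℤ` (`TorusChart.lean`) whose periods are NOT powers of the blocking factor: at scale `j` every
axis of period `N` is cut into `N / 2^j` cyclic intervals, the cells `[k 2^j, (k+1) 2^j)` for `k < N/2^j - 1`
and a last cell `[(N/2^j - 1) 2^j, N)` of length in `[2^j, 2^{j+1})` absorbing the remainder (the explicit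
cyclic frame `axisFrame N 2^j (N/2^j - 1)` of `ZModTorusFrames.lean`, read on canonical representatives), and the
blocks of scale `j` are the products of cells.  The point proved here is that these towers are NESTED although
`N` is arbitrary: the scale-`(j+1)` label is a function of the scale-`j` label (`dyLabel_succ`,
`blockOf_succ : blockOf (j+1) = coarsenBlock j ∘ blockOf j`), which is exactly the input `π_j` of the generic
reblocking map `PolymerReblocking.reblock` / `rgMap`.

* `dyMu N j = N / 2^j - 1`, `dyLabel N j u = min (u / 2^j) (dyMu N j)` (the scale-`j` cell of the representative
  `u`), `dyCoarsen N j k = min (k / 2) (dyMu N (j+1))`; `dyLabel_succ`; the cells as half-open intervals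
  `[dyLo j k, dyHi N j k)` (`dyLabel_eq_iff`) of length in `[2^j, 2^{j+1}]` (`two_pow_le_dyLen`, `dyLen_le`).
* `blockOf F j x : Fin d → ℕ` (coordinatewise labels), `blockOf_zero` (scale `0` = the coordinates, injective),
  `blockOf_succ` (nestedness), `block F j b` (the block as a `Finset`), the partition of the torus into blocks,
  the box description `mem_block_iff_cval`, and the cardinality `card_block = ∏ᵢ dyLen` with
  `2^{jd} ≤ |block| ≤ 2^{(j+1)d}` (`two_pow_le_card_block`, `card_block_le`).
-/

namespace Literature.MathematicalPhysics.QuantumFieldTheory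

open scoped BigOperators
open Literature.Probability.LatticeModels (frameLabel frameLabel_le frameLabel_mul_le lt_frameLabel_mul_add_or
  axisFrame_bounds_of_div)

namespace TorusChart

/-! ## Dyadic cells on one axis -/

section Axis

variable {N j u k : ℕ}

/-- The number of dyadic cells of scale `j` on an axis of period `N`, minus one: `N / 2^j - 1`. [folklore] -/
def dyMu (N j : ℕ) : ℕ := N / 2 ^ j - 1

/-- The **dyadic label** of scale `j` of a representative `u`: `min (u / 2^j) (N / 2^j - 1)` — the cell
`[k 2^j, (k+1) 2^j)` containing `u`, the last cell absorbing the remainder of `N` modulo `2^j`. [folklore] -/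
def dyLabel (N j u : ℕ) : ℕ := frameLabel (2 ^ j) (dyMu N j) u

/-- Unfolding `dyLabel`. [folklore] -/
theorem dyLabel_eq_min (N j u : ℕ) : dyLabel N j u = min (u / 2 ^ j) (dyMu N j) := rfl

/-- Labels are at most `dyMu`. [folklore] -/
theorem dyLabel_le (N j u : ℕ) : dyLabel N j u ≤ dyMu N j := frameLabel_le _

/-- Labels are monotone in the representative. [folklore] -/
theorem dyLabel_mono (N j : ℕ) {u v : ℕ} (h : u ≤ v) : dyLabel N j u ≤ dyLabel N j v :=
  Literature.Probability.LatticeModels.frameLabel_mono h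

/-- The cell of `u` starts at or before `u`. [folklore] -/
theorem dyLabel_mul_le (N j u : ℕ) : dyLabel N j u * 2 ^ j ≤ u := frameLabel_mul_le _

/-- The frame inequalities `(μ+1) 2^j ≤ N < (μ+2) 2^j` for `μ = dyMu N j`, valid while `2^j ≤ N`. [folklore] -/
theorem dyMu_bounds (h : 2 ^ j ≤ N) : dyMu N j * 2 ^ j + 2 ^ j ≤ N ∧ N < dyMu N j * 2 ^ j + 2 * 2 ^ j :=
  axisFrame_bounds_of_div (pow_pos two_pos j) h

/-- At scale `0` the label is the representative itself. [folklore] -/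
theorem dyLabel_scale_zero (hu : u < N) : dyLabel N 0 u = u := by
  rw [dyLabel_eq_min, pow_zero, Nat.div_one, dyMu, pow_zero, Nat.div_one]
  exact min_eq_left (by omega)

/-- Beyond the top scale (`N < 2^j`... more precisely `N / 2^j ≤ 1`) there is a single cell. [folklore] -/
theorem dyLabel_eq_zero_of_div_le_one (h : N / 2 ^ j ≤ 1) (u : ℕ) : dyLabel N j u = 0 := by
  have : dyMu N j = 0 := by rw [dyMu]; omega
  have h' := dyLabel_le N j u
  rw [this] at h'
  exact Nat.le_zero.1 h'

/-- **Nestedness of the cell counts**: `2 · dyMu N (j+1) ≤ dyMu N j`. [folklore] -/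
theorem two_mul_dyMu_succ_le (N j : ℕ) : 2 * dyMu N (j + 1) ≤ dyMu N j := by
  rw [dyMu, dyMu, pow_succ, ← Nat.div_div_eq_div_mul]
  have := Nat.div_add_mod (N / 2 ^ j) 2
  omega

/-- The **one-step coarsening of labels**: `k ↦ min (k / 2) (dyMu N (j+1))`. [folklore] -/
def dyCoarsen (N j k : ℕ) : ℕ := min (k / 2) (dyMu N (j + 1))

/-- **Nestedness of dyadic cells on an axis of arbitrary period**: the scale-`(j+1)` label is the coarsening of
the scale-`j` label. [folklore] -/
theorem dyLabel_succ (N j u : ℕ) : dyLabel N (j + 1) u = dyCoarsen N j (dyLabel N j u) := by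
  rw [dyLabel_eq_min, dyLabel_eq_min, dyCoarsen, pow_succ, ← Nat.div_div_eq_div_mul]
  have hμ := two_mul_dyMu_succ_le N j
  rcases le_total (u / 2 ^ j) (dyMu N j) with h | h
  · rw [min_eq_left h]
  · rw [min_eq_right h]
    have h1 : dyMu N (j + 1) ≤ u / 2 ^ j / 2 := by
      have := Nat.div_le_div_right (c := 2) h
      omega
    have h2 : dyMu N (j + 1) ≤ dyMu N j / 2 := by omega
    rw [min_eq_right h1, min_eq_right h2]

/-- Coarsening is monotone. [folklore] -/
theorem dyCoarsen_mono (N j : ℕ) {k k' : ℕ} (h : k ≤ k') : dyCoarsen N j k ≤ dyCoarsen N j k' :=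
  min_le_min_right _ (Nat.div_le_div_right h)

/-- The left end of the cell with label `k` at scale `j`. [folklore] -/
def dyLo (j k : ℕ) : ℕ := k * 2 ^ j

/-- The right end (exclusive) of the cell with label `k` at scale `j` on an axis of period `N`: `(k+1) 2^j` for
the regular cells, `N` for the last one. [folklore] -/
def dyHi (N j k : ℕ) : ℕ := if k < dyMu N j then k * 2 ^ j + 2 ^ j else N

/-- The length of the cell with label `k`. [folklore] -/
def dyLen (N j k : ℕ) : ℕ := dyHi N j k - dyLo j k

/-- **Cells are half-open intervals of representatives**: for `2^j ≤ N`, `u < N` and `k ≤ dyMu N j`,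
`dyLabel N j u = k ↔ dyLo j k ≤ u < dyHi N j k`. [folklore] -/
theorem dyLabel_eq_iff (h : 2 ^ j ≤ N) (hu : u < N) (hk : k ≤ dyMu N j) :
    dyLabel N j u = k ↔ dyLo j k ≤ u ∧ u < dyHi N j k := by
  have hb : 0 < 2 ^ j := pow_pos two_pos j
  obtain ⟨h1, h2⟩ := dyMu_bounds h
  rw [dyLo, dyHi]
  constructor
  · intro hl
    subst hl
    refine ⟨dyLabel_mul_le N j u, ?_⟩
    split_ifs with hlt
    · rcases lt_frameLabel_mul_add_or (μ := dyMu N j) hb u with h' | h'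
      · exact h'
      · exact absurd h' hlt.ne
    · exact hu
  · rintro ⟨hlo, hhi⟩
    rw [dyLabel_eq_min]
    split_ifs at hhi with hlt
    · have : u / 2 ^ j = k := by
        apply Nat.div_eq_of_lt_le
        · exact hlo
        · rw [add_mul, one_mul]; exact hhi
      rw [this]; exact min_eq_left hk
    · have hkμ : k = dyMu N j := le_antisymm hk (not_lt.1 hlt)
      subst hkμ
      apply min_eq_right
      rw [Nat.le_div_iff_mul_le hb]
      exact hlo

/-- The cell of `u` contains `u` (interval form). [folklore] -/
theorem dyLo_le_and_lt_dyHi (h : 2 ^ j ≤ N) (hu : u < N) :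
    dyLo j (dyLabel N j u) ≤ u ∧ u < dyHi N j (dyLabel N j u) :=
  (dyLabel_eq_iff h hu (dyLabel_le N j u)).1 rfl

/-- Cells end inside the axis. [folklore] -/
theorem dyHi_le (h : 2 ^ j ≤ N) (k : ℕ) : dyHi N j k ≤ N := by
  obtain ⟨h1, _⟩ := dyMu_bounds h
  rw [dyHi]
  split_ifs with hlt
  · calc k * 2 ^ j + 2 ^ j ≤ dyMu N j * 2 ^ j + 2 ^ j := by
          have := Nat.mul_le_mul_right (2 ^ j) hlt.le; omega
      _ ≤ N := h1
  · exact le_rfl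

/-- **Cells have length at least `2^j`.** [folklore] -/
theorem two_pow_le_dyLen (h : 2 ^ j ≤ N) (hk : k ≤ dyMu N j) : 2 ^ j ≤ dyLen N j k := by
  obtain ⟨h1, _⟩ := dyMu_bounds h
  rw [dyLen, dyHi, dyLo]
  split_ifs with hlt
  · omega
  · have hkμ : k = dyMu N j := le_antisymm hk (not_lt.1 hlt)
    subst hkμ; omega

/-- **Cells have length at most `2^{j+1}`.** [folklore] -/
theorem dyLen_le (h : 2 ^ j ≤ N) (hk : k ≤ dyMu N j) : dyLen N j k ≤ 2 ^ (j + 1) := by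
  obtain ⟨_, h2⟩ := dyMu_bounds h
  rw [dyLen, dyHi, dyLo, pow_succ]
  split_ifs with hlt
  · omega
  · have hkμ : k = dyMu N j := le_antisymm hk (not_lt.1 hlt)
    subst hkμ; omega

/-- `dyLo + dyLen = dyHi`. [folklore] -/
theorem dyLo_add_dyLen (h : 2 ^ j ≤ N) (hk : k ≤ dyMu N j) : dyLo j k + dyLen N j k = dyHi N j k := by
  have hb : 0 < 2 ^ j := pow_pos two_pos j
  have : dyLo j k ≤ dyHi N j k := by
    have := two_pow_le_dyLen h hk
    rw [dyLen] at this
    omega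
  rw [dyLen]; omega

end Axis

/-! ## Blocks on a charted torus -/

variable {Λ : Type*} [AddCommGroup Λ] {d : ℕ} (F : TorusChart Λ d)

/-- The **block label** of a site at scale `j`: the dyadic labels of its coordinates. [folklore] -/
def blockOf (j : ℕ) (x : Λ) : Fin d → ℕ := fun i => dyLabel (F.period i) j (F.cval i x)

/-- Unfolding `blockOf`. [folklore] -/
theorem blockOf_apply (j : ℕ) (x : Λ) (i : Fin d) : F.blockOf j x i = dyLabel (F.period i) j (F.cval i x) := rfl

/-- **Scale `0`: the block label is the coordinate tuple.** [folklore] -/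
theorem blockOf_zero (x : Λ) : F.blockOf 0 x = fun i => F.cval i x := by
  funext i; exact dyLabel_scale_zero (F.cval_lt i x)

/-- Scale-`0` blocks are single sites. [folklore] -/
theorem blockOf_zero_injective : Function.Injective (F.blockOf 0) := fun x y h =>
  F.ext_cval fun i => by
    have := congr_fun h i
    rwa [blockOf_zero, blockOf_zero] at this

/-- The **coarsening map on block labels** (coordinatewise `dyCoarsen`): the blocking map `π_j` from scale `j`
to scale `j+1`. [folklore] -/
def coarsenBlock (j : ℕ) (b : Fin d → ℕ) : Fin d → ℕ := fun i => dyCoarsen (F.period i) j (b i)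

/-- **Nestedness of the block tower**: `blockOf (j+1) = coarsenBlock j ∘ blockOf j`. [folklore] -/
theorem blockOf_succ (j : ℕ) (x : Λ) : F.blockOf (j + 1) x = F.coarsenBlock j (F.blockOf j x) := by
  funext i; exact dyLabel_succ _ _ _

/-- Sites in a common block stay in a common block at all coarser scales. [folklore] -/
theorem blockOf_add_eq_of_eq {j : ℕ} {x y : Λ} (h : F.blockOf j x = F.blockOf j y) (n : ℕ) :
    F.blockOf (j + n) x = F.blockOf (j + n) y := by
  induction n with
  | zero => simpa using h
  | succ n ih => rw [← add_assoc, blockOf_succ, blockOf_succ, ih]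

/-- Block labels are bounded by the cell counts. [folklore] -/
theorem blockOf_le (j : ℕ) (x : Λ) (i : Fin d) : F.blockOf j x i ≤ dyMu (F.period i) j := dyLabel_le _ _ _

section Finite

variable [Fintype Λ]

/-- The **block** with label `b` at scale `j`, as a set of sites. [folklore] -/
noncomputable def block (j : ℕ) (b : Fin d → ℕ) : Finset Λ := Finset.univ.filter fun x => F.blockOf j x = b

/-- Membership in a block. [folklore] -/
@[simp] theorem mem_block_iff (j : ℕ) (b : Fin d → ℕ) (x : Λ) : x ∈ F.block j b ↔ F.blockOf j x = b := by
  simp [block]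

/-- Every site lies in its own block. [folklore] -/
theorem mem_block_blockOf (j : ℕ) (x : Λ) : x ∈ F.block j (F.blockOf j x) := (F.mem_block_iff j _ x).2 rfl

/-- Distinct labels give disjoint blocks. [folklore] -/
theorem disjoint_block {j : ℕ} {b b' : Fin d → ℕ} (h : b ≠ b') : Disjoint (F.block j b) (F.block j b') :=
  Finset.disjoint_left.2 fun x hx hx' => h (((F.mem_block_iff j b x).1 hx).symm.trans ((F.mem_block_iff j b' x).1 hx'))

/-- **Blocks refine coarser blocks**: a scale-`j` block lies inside the scale-`(j+1)` block of its coarsened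
label. [folklore] -/
theorem block_subset_block_succ (j : ℕ) (b : Fin d → ℕ) : F.block j b ⊆ F.block (j + 1) (F.coarsenBlock j b) := by
  intro x hx
  rw [mem_block_iff] at hx ⊢
  rw [blockOf_succ, hx]

/-- **A coarse block is the union of the fine blocks it contains.** [folklore] -/
theorem block_succ_eq_biUnion [DecidableEq Λ] (j : ℕ) (b' : Fin d → ℕ) :
    F.block (j + 1) b' =
      ((Finset.univ.image (F.blockOf j)).filter fun b => F.coarsenBlock j b = b').biUnion (F.block j) := by
  ext x
  simp only [mem_block_iff, Finset.mem_biUnion, Finset.mem_filter, Finset.mem_image, Finset.mem_univ, true_and]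
  constructor
  · intro hx
    exact ⟨F.blockOf j x, ⟨⟨x, rfl⟩, by rw [← blockOf_succ, hx]⟩, rfl⟩
  · rintro ⟨b, ⟨_, hb⟩, hxb⟩
    rw [blockOf_succ, hxb, hb]

/-- **Box description of blocks**: while `2^j ≤ N_i` on every axis, a site lies in the block with label
`b ≤ dyMu` iff its coordinates lie in the cells `[dyLo j (b i), dyHi N_i j (b i))`. [folklore] -/
theorem mem_block_iff_cval {j : ℕ} (hj : ∀ i, 2 ^ j ≤ F.period i) {b : Fin d → ℕ}
    (hb : ∀ i, b i ≤ dyMu (F.period i) j) (x : Λ) :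
    x ∈ F.block j b ↔ ∀ i, dyLo j (b i) ≤ F.cval i x ∧ F.cval i x < dyHi (F.period i) j (b i) := by
  rw [mem_block_iff]
  constructor
  · intro h i
    exact (dyLabel_eq_iff (hj i) (F.cval_lt i x) (hb i)).1 (congr_fun h i)
  · intro h
    funext i
    exact (dyLabel_eq_iff (hj i) (F.cval_lt i x) (hb i)).2 (h i)

/-- **The cardinality of a block is the product of its cell lengths.** [folklore] -/
theorem card_block {j : ℕ} (hj : ∀ i, 2 ^ j ≤ F.period i) {b : Fin d → ℕ}
    (hb : ∀ i, b i ≤ dyMu (F.period i) j) : (F.block j b).card = ∏ i, dyLen (F.period i) j (b i) := by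
  classical
  -- the bijection `block ≃ ∏ᵢ Fin (dyLen i)` through the coordinates
  have hmem := F.mem_block_iff_cval hj hb
  let e : (F.block j b) ≃ (∀ i : Fin d, Fin (dyLen (F.period i) j (b i))) :=
    { toFun := fun x i => ⟨F.cval i x.1 - dyLo j (b i), by
        have h := (hmem x.1).1 x.2 i
        have := dyLo_add_dyLen (hj i) (hb i)
        rw [dyLen] at this ⊢
        omega⟩
      invFun := fun t => ⟨F.site fun i => dyLo j (b i) + t i, (hmem _).2 fun i => by
        have hlt : dyLo j (b i) + (t i : ℕ) < F.period i := by
          have := (t i).isLt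
          have h2 := dyLo_add_dyLen (hj i) (hb i)
          have h3 := dyHi_le (hj i) (b i)
          omega
        rw [F.cval_site (fun i => by
          have := (t i).isLt
          have h2 := dyLo_add_dyLen (hj i) (hb i)
          have h3 := dyHi_le (hj i) (b i)
          omega)]
        have := (t i).isLt
        have h2 := dyLo_add_dyLen (hj i) (hb i)
        constructor <;> omega⟩
      left_inv := fun x => by
        apply Subtype.ext
        refine F.ext_cval fun i => ?_
        rw [F.cval_site]
        · have h := (hmem x.1).1 x.2 i
          simp only
          omega
        · intro i
          have h := (hmem x.1).1 x.2 i
          have h3 := dyHi_le (hj i) (b i)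
          simp only
          omega
      right_inv := fun t => by
        funext i
        apply Fin.ext
        simp only
        rw [F.cval_site]
        · omega
        · intro i
          have := (t i).isLt
          have h2 := dyLo_add_dyLen (hj i) (hb i)
          have h3 := dyHi_le (hj i) (b i)
          omega }
  rw [← Fintype.card_coe, Fintype.card_congr e, Fintype.card_pi]
  simp only [Fintype.card_fin]

/-- **Blocks have at least `2^{jd}` sites.** [folklore] -/
theorem two_pow_le_card_block {j : ℕ} (hj : ∀ i, 2 ^ j ≤ F.period i) {b : Fin d → ℕ}
    (hb : ∀ i, b i ≤ dyMu (F.period i) j) : 2 ^ (j * d) ≤ (F.block j b).card := by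
  rw [F.card_block hj hb, pow_mul, ← Fin.prod_const]
  exact Finset.prod_le_prod' fun i _ => two_pow_le_dyLen (hj i) (hb i)

/-- **Blocks have at most `2^{(j+1)d}` sites.** [folklore] -/
theorem card_block_le {j : ℕ} (hj : ∀ i, 2 ^ j ≤ F.period i) {b : Fin d → ℕ}
    (hb : ∀ i, b i ≤ dyMu (F.period i) j) : (F.block j b).card ≤ 2 ^ ((j + 1) * d) := by
  rw [F.card_block hj hb, pow_mul, ← Fin.prod_const]
  exact Finset.prod_le_prod' fun i _ => dyLen_le (hj i) (hb i)

omit [Fintype Λ] in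
/-- While `2^j ≤ N_i` on every axis, every label tuple bounded by the cell counts is the label of a site
(the corner of the box). [folklore] -/
theorem exists_blockOf_eq {j : ℕ} (hj : ∀ i, 2 ^ j ≤ F.period i) {b : Fin d → ℕ}
    (hb : ∀ i, b i ≤ dyMu (F.period i) j) : ∃ x : Λ, F.blockOf j x = b := by
  have hlt : ∀ i, dyLo j (b i) < F.period i := fun i => by
    have h2 := dyLo_add_dyLen (hj i) (hb i)
    have h3 := dyHi_le (hj i) (b i)
    have h4 := two_pow_le_dyLen (hj i) (hb i)
    have : 0 < 2 ^ j := pow_pos two_pos j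
    omega
  refine ⟨F.site fun i => dyLo j (b i), funext fun i => ?_⟩
  rw [blockOf_apply, F.cval_site hlt]
  refine (dyLabel_eq_iff (hj i) (hlt i) (hb i)).2 ⟨le_rfl, ?_⟩
  have h2 := dyLo_add_dyLen (hj i) (hb i)
  have h4 := two_pow_le_dyLen (hj i) (hb i)
  have : 0 < 2 ^ j := pow_pos two_pos j
  omega

/-- **The number of blocks at scale `j`** is `∏ᵢ (N_i / 2^j)` while `2^j ≤ N_i` on every axis. [folklore] -/
theorem card_image_blockOf [DecidableEq (Fin d → ℕ)] {j : ℕ} (hj : ∀ i, 2 ^ j ≤ F.period i) :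
    (Finset.univ.image (F.blockOf j)).card = ∏ i, (F.period i / 2 ^ j) := by
  have hμ : ∀ i, dyMu (F.period i) j + 1 = F.period i / 2 ^ j := fun i => by
    have : 1 ≤ F.period i / 2 ^ j := (Nat.le_div_iff_mul_le (pow_pos two_pos j)).2 (by simpa using hj i)
    rw [dyMu]; omega
  have himage : Finset.univ.image (F.blockOf j) =
      Fintype.piFinset fun i => Finset.range (dyMu (F.period i) j + 1) := by
    ext b
    simp only [Finset.mem_image, Finset.mem_univ, true_and, Fintype.mem_piFinset, Finset.mem_range,
      Nat.lt_succ_iff]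
    constructor
    · rintro ⟨x, rfl⟩ i
      exact F.blockOf_le j x i
    · intro hb
      exact F.exists_blockOf_eq hj hb
  rw [himage, Fintype.card_piFinset]
  exact Finset.prod_congr rfl fun i _ => by rw [Finset.card_range, hμ i]

end Finite

end TorusChart

end Literature.MathematicalPhysics.QuantumFieldTheory
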